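import Literature.NumberTheory.EllipticCurves.FormalGroupTranslationTaylorProofs
import Literature.NumberTheory.EllipticCurves.FormalGroupTranslationLaurentProofs
import Mathlib.Analysis.Calculus.Deriv.Shift
import HarnessLib

/-!
# `𝓣[v ↦ y(ξ(Ω + v))] = translateY(x₀, y₀) ∘ exp_W`: the `y`-coordinate twin of the translate expansion (Silverman AEC VI.3.6, IV.1;
# de Shalit II.4.9 — proofs only)

Topic `NumberTheory/EllipticCurves` (theorems only; no definition, no named fact, no instance).  Sequel of
`FormalGroupTranslationTaylorProofs` (★★ `taylor_weierstrassP_add_sub_eq_translateX_subst_formalExp`: for `Ω ∉ Λ` the Taylor series at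
`0` of `v ↦ x(ξ(Ω + v))` is `translateX(ξ Ω) ∘ exp_W`) and of `FormalGroupTranslationLaurentProofs` (`some_add_laurentPt`:
`P₀ + P(t) = (translateX, translateY)` in `E(k⸨t⸩)`).  Here the `y`-coordinate, WITHOUT a second chord computation:

* `constantCoeff_subst_of_constantCoeff_eq_zero'` — `(f ∘ g)(0) = f(0)` for `g(0) = 0`; `constantCoeff_translateY_add` —
  `translateY(0) + y₀ + a₁x₀ + a₃ = [t¹] translateX`;
* `equation_translate_subst_formalExp` — `(TX, TY) := (translateX ∘ exp_W, translateY ∘ exp_W)` satisfies the Weierstrass equation in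
  `ℂ⟦z⟧` (from `some_add_laurentPt`);
* `equation_taylor_translate` — so does `(𝓣[x(ξ(Ω + ·))], 𝓣[y(ξ(Ω + ·))])` (the points `ξ(Ω + v)` lie on the curve; Taylor series are
  multiplicative); `coeff_one_taylor_x_translate` — `[z¹] 𝓣[x(ξ(Ω + ·))] = ℘′(Ω)`;
* ★★ `taylor_y_translate_eq_translateY_subst_formalExp` — **`𝓣[v ↦ y(ξ(Ω + v))] = translateY(ξ Ω) ∘ exp_W`** for `Ω ∉ Λ` with
  `℘′(Ω) ≠ 0` (`2Ω ∉ Λ`): two `y`-coordinates over the SAME `x`-coordinate `TX` in the domain `ℂ⟦z⟧` are equal or «opposite», and the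
  opposite case is excluded by the constant terms (`translateY(0) + y₀ + a₁x₀ + a₃ = [z¹]TX = ℘′(Ω) ≠ 0`).

Use: the `y`-half of the CM transformation identity on the formal group (cell `bsd-print-cf2`, (CM-POINTS)(ii); the `x`-half is
`CMFormalActionTaylorProofs`).  Seat `bsd-line-cf2c-w4` g14; no summit statement is proved; BSD is not proved by any of this.

## References
* [SilvermanAEC2009] J. H. Silverman, *The Arithmetic of Elliptic Curves*, 2nd ed. (2009), III.2.3, IV.1, VI.3.6.
* [deShalit1987] E. de Shalit, *Iwasawa theory of elliptic curves with complex multiplication* (1987), II §4.9 (proof of (i)).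
-/

noncomputable section

open PowerSeries Filter Set Literature.NumberTheory.Transcendental.AndreCriterion
open scoped Topology Nat Classical

/-- The Taylor series of `f : ℂ → ℂ` at `0` (local notation, as in `AndreCriterionAnalyticProofs`). -/
local notation3 "𝓣[" f "]" =>
  (PowerSeries.mk fun n => ((Nat.factorial n : ℂ)⁻¹ * iteratedDeriv n f 0) : PowerSeries ℂ)

namespace WeierstrassCurve

open PeriodPair Literature.NumberTheory.EllipticCurves

/-! ## §1 Formal preliminaries -/

section Formal

variable {R : Type*} [CommRing R] (V : WeierstrassCurve R)

/-- `(f ∘ g)(0) = f(0)` for `g(0) = 0`. [cite: SilvermanAEC2009, IV.1] -/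
theorem _root_.Literature.NumberTheory.EllipticCurves.constantCoeff_subst_of_constantCoeff_eq_zero' (f : PowerSeries R)
    {g : PowerSeries R} (hg : constantCoeff g = 0) : constantCoeff (PowerSeries.subst g f) = constantCoeff f := by
  have hs : HasSubst g := HasSubst.of_constantCoeff_zero' hg
  have h0 : constantCoeff (f - C (constantCoeff f)) = 0 := by rw [map_sub, constantCoeff_C, sub_self]
  have h1 : constantCoeff (PowerSeries.subst g (f - C (constantCoeff f))) = 0 := constantCoeff_subst_eq_zero hg _ h0
  rw [← coe_substAlgHom hs, map_sub, substAlgHom_C, coe_substAlgHom, map_sub, constantCoeff_C, sub_eq_zero] at h1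
  exact h1

/-- **`translateY(0) + y₀ + a₁x₀ + a₃ = [t¹] translateX`** (from the definition `translateY = u·H − y₀ − a₁·translateX − a₃`, `u(0) = 1`,
`H(0) = [t¹] translateX`, `translateX(0) = x₀`). [cite: SilvermanAEC2009, III.2.3] -/
theorem constantCoeff_translateY_add (x₀ y₀ : R) :
    constantCoeff (V.translateY x₀ y₀) + y₀ + V.a₁ * x₀ + V.a₃ = coeff 1 (V.translateX x₀ y₀) := by
  have hH : constantCoeff (V.translateXSubDivX x₀ y₀) = coeff 1 (V.translateX x₀ y₀) := by
    rw [← coeff_zero_eq_constantCoeff_apply, translateXSubDivX, coeff_mk]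
  rw [translateY_def', map_sub, map_sub, map_sub, map_mul, constantCoeff_translateSlopeNum, one_mul, hH, constantCoeff_C, map_mul,
    constantCoeff_C, constantCoeff_translateX, constantCoeff_C]
  ring

end Formal

/-! ## §2 Both candidates satisfy the Weierstrass equation -/

variable (L : PeriodPair) (W : WeierstrassCurve ℂ)

/-- **`(translateX ∘ exp_W, translateY ∘ exp_W)` satisfies the Weierstrass equation in `ℂ⟦z⟧`** (it is the point `P₀ + P(t)` of `E(ℂ⸨t⸩)`,
`some_add_laurentPt`, read in `ℂ⟦t⟧` and composed with `exp_W`). [cite: SilvermanAEC2009, III.2.3, IV.1] -/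
theorem equation_translate_subst_formalExp [W.IsElliptic] {x₀ y₀ : ℂ} (h₀ : W.toAffine.Nonsingular x₀ y₀) :
    ((W.translateY x₀ y₀).subst W.formalExp) ^ 2 + C W.a₁ * (W.translateX x₀ y₀).subst W.formalExp * (W.translateY x₀ y₀).subst W.formalExp +
        C W.a₃ * (W.translateY x₀ y₀).subst W.formalExp =
      ((W.translateX x₀ y₀).subst W.formalExp) ^ 3 + C W.a₂ * ((W.translateX x₀ y₀).subst W.formalExp) ^ 2 +
        C W.a₄ * (W.translateX x₀ y₀).subst W.formalExp + C W.a₆ := by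
  obtain ⟨h₃, -⟩ := some_add_laurentPt (E := W) h₀
  have heq := (Affine.equation_iff _ _).mp h₃.1
  simp only [baseChange, map_a₁, map_a₂, map_a₃, map_a₄, map_a₆, algebraMap_laurentSeries_eq_coe_C, ← PowerSeries.coe_mul,
    ← PowerSeries.coe_pow, ← PowerSeries.coe_add] at heq
  have heq' : (W.translateY x₀ y₀) ^ 2 + C W.a₁ * W.translateX x₀ y₀ * W.translateY x₀ y₀ + C W.a₃ * W.translateY x₀ y₀ =
      (W.translateX x₀ y₀) ^ 3 + C W.a₂ * (W.translateX x₀ y₀) ^ 2 + C W.a₄ * W.translateX x₀ y₀ + C W.a₆ :=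
    HahnSeries.ofPowerSeries_injective heq
  have hs : HasSubst W.formalExp := HasSubst.of_constantCoeff_zero' W.constantCoeff_formalExp
  have h := congrArg (PowerSeries.subst W.formalExp) heq'
  simp only [← coe_substAlgHom hs, map_add, map_mul, map_pow, Literature.NumberTheory.EllipticCurves.substAlgHom_C] at h
  simp only [coe_substAlgHom hs] at h
  exact h

/-- `Ω + v ∉ Λ` near `v = 0` for `Ω ∉ Λ`. [cite: SilvermanAEC2009, VI.3.6] -/
theorem eventually_const_add_notMem_lattice {Ω : ℂ} (hΩ : Ω ∉ L.lattice) : ∀ᶠ v in 𝓝 (0 : ℂ), Ω + v ∉ L.lattice := by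
  have hopen : IsOpen ((L.lattice : Set ℂ)ᶜ) := L.isClosed_lattice.isOpen_compl
  have hcont : Continuous fun v : ℂ => Ω + v := continuous_const.add continuous_id
  have : (fun v : ℂ => Ω + v) ⁻¹' (L.lattice : Set ℂ)ᶜ ∈ 𝓝 (0 : ℂ) :=
    hcont.continuousAt.preimage_mem_nhds (hopen.mem_nhds (by simpa using hΩ))
  filter_upwards [this] with v hv
  exact hv

/-- `v ↦ x(ξ(Ω + v)) = ℘(Ω + v) − b₂/12` is analytic at `0` (`Ω ∉ Λ`). [cite: SilvermanAEC2009, VI.3.1] -/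
theorem analyticAt_x_translate {Ω : ℂ} (hΩ : Ω ∉ L.lattice) : AnalyticAt ℂ (fun v : ℂ => ℘[L] (Ω + v) - W.b₂ / 12) 0 :=
  ((L.analyticOnNhd_weierstrassP (Ω + 0) (by simpa using hΩ)).comp (analyticAt_const.add analyticAt_id)).sub analyticAt_const

/-- `v ↦ y(ξ(Ω + v)) = (℘′(Ω + v) − a₁x − a₃)/2` is analytic at `0` (`Ω ∉ Λ`). [cite: SilvermanAEC2009, VI.3.1] -/
theorem analyticAt_y_translate {Ω : ℂ} (hΩ : Ω ∉ L.lattice) :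
    AnalyticAt ℂ (fun v : ℂ => (℘'[L] (Ω + v) - W.a₁ * (℘[L] (Ω + v) - W.b₂ / 12) - W.a₃) / 2) 0 := by
  have h1 : AnalyticAt ℂ (fun v : ℂ => ℘'[L] (Ω + v)) 0 :=
    (L.analyticOnNhd_derivWeierstrassP (Ω + 0) (by simpa using hΩ)).comp (analyticAt_const.add analyticAt_id)
  have h2 : AnalyticAt ℂ (fun v : ℂ => ℘'[L] (Ω + v) - W.a₁ * (℘[L] (Ω + v) - W.b₂ / 12) - W.a₃) 0 :=
    (h1.sub (analyticAt_const.mul (analyticAt_x_translate L W hΩ))).sub analyticAt_const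
  exact h2.div_const

/-- **`(𝓣[x(ξ(Ω + ·))], 𝓣[y(ξ(Ω + ·))])` satisfies the Weierstrass equation in `ℂ⟦z⟧`** (the points `ξ(Ω + v)` do, for `v` near `0`,
and Taylor series are multiplicative). [cite: SilvermanAEC2009, VI.3.6] -/
theorem equation_taylor_translate (h₂ : L.g₂ = W.c₄ / 12) (h₃ : L.g₃ = W.c₆ / 216) {Ω : ℂ} (hΩ : Ω ∉ L.lattice) :
    𝓣[fun v => (℘'[L] (Ω + v) - W.a₁ * (℘[L] (Ω + v) - W.b₂ / 12) - W.a₃) / 2] ^ 2 +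
        C W.a₁ * 𝓣[fun v => ℘[L] (Ω + v) - W.b₂ / 12] * 𝓣[fun v => (℘'[L] (Ω + v) - W.a₁ * (℘[L] (Ω + v) - W.b₂ / 12) - W.a₃) / 2] +
        C W.a₃ * 𝓣[fun v => (℘'[L] (Ω + v) - W.a₁ * (℘[L] (Ω + v) - W.b₂ / 12) - W.a₃) / 2] =
      𝓣[fun v => ℘[L] (Ω + v) - W.b₂ / 12] ^ 3 + C W.a₂ * 𝓣[fun v => ℘[L] (Ω + v) - W.b₂ / 12] ^ 2 +
        C W.a₄ * 𝓣[fun v => ℘[L] (Ω + v) - W.b₂ / 12] + C W.a₆ := by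
  obtain ⟨u, -, -, hu⟩ := PeriodPair.exists_addMonoidHom_of_g₂_g₃' (L := L) h₂ h₃
  set F : ℂ → ℂ := fun v => ℘[L] (Ω + v) - W.b₂ / 12 with hF
  set G : ℂ → ℂ := fun v => (℘'[L] (Ω + v) - W.a₁ * (℘[L] (Ω + v) - W.b₂ / 12) - W.a₃) / 2 with hG
  have hFa : AnalyticAt ℂ F 0 := analyticAt_x_translate L W hΩ
  have hGa : AnalyticAt ℂ G 0 := analyticAt_y_translate L W hΩ
  set c1 : ℂ → ℂ := fun _ => W.a₁ with hc1
  set c2 : ℂ → ℂ := fun _ => W.a₂ with hc2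
  set c3 : ℂ → ℂ := fun _ => W.a₃ with hc3
  set c4 : ℂ → ℂ := fun _ => W.a₄ with hc4
  set c6 : ℂ → ℂ := fun _ => W.a₆ with hc6
  have hc1a : AnalyticAt ℂ c1 0 := analyticAt_const
  have hc2a : AnalyticAt ℂ c2 0 := analyticAt_const
  have hc3a : AnalyticAt ℂ c3 0 := analyticAt_const
  have hc4a : AnalyticAt ℂ c4 0 := analyticAt_const
  have hc6a : AnalyticAt ℂ c6 0 := analyticAt_const
  -- the Weierstrass equation at the points `ξ(Ω + v)`
  have hev : (G ^ 2 + c1 * F * G + c3 * G) =ᶠ[𝓝 0] (F ^ 3 + c2 * F ^ 2 + c4 * F + c6) := by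
    filter_upwards [eventually_const_add_notMem_lattice L hΩ] with v hv
    obtain ⟨hz, -⟩ := hu (Ω + v) hv
    have e := (Affine.equation_iff _ _).mp hz.1
    simp only [Pi.add_apply, Pi.mul_apply, Pi.pow_apply, hc1, hc2, hc3, hc4, hc6, hF, hG]
    exact e
  have hT := taylor_congr hev
  rw [taylor_add ((hGa.pow 2).add ((hc1a.mul hFa).mul hGa)) (hc3a.mul hGa), taylor_add (hGa.pow 2) ((hc1a.mul hFa).mul hGa),
    taylor_pow hGa 2, taylor_mul (hc1a.mul hFa) hGa, taylor_mul hc1a hFa, taylor_mul hc3a hGa,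
    taylor_add (((hFa.pow 3).add (hc2a.mul (hFa.pow 2))).add (hc4a.mul hFa)) hc6a,
    taylor_add ((hFa.pow 3).add (hc2a.mul (hFa.pow 2))) (hc4a.mul hFa), taylor_add (hFa.pow 3) (hc2a.mul (hFa.pow 2)),
    taylor_pow hFa 3, taylor_mul hc2a (hFa.pow 2), taylor_pow hFa 2, taylor_mul hc4a hFa, hc1, hc2, hc3, hc4, hc6,
    taylor_const, taylor_const, taylor_const, taylor_const, taylor_const] at hT
  exact hT

/-- `[z¹] f(g) = [z¹]f · [z¹]g` for `g(0) = 0`. [cite: SilvermanAEC2009, IV.1] -/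
private theorem coeff_one_subst_eq_mul'' (f : ℂ⟦X⟧) {g : ℂ⟦X⟧} (hg : constantCoeff g = 0) :
    coeff 1 (f.subst g) = coeff 1 f * coeff 1 g := by
  rw [coeff_subst' (HasSubst.of_constantCoeff_zero' hg), finsum_eq_single _ 1]
  · rw [pow_one, smul_eq_mul]
  · intro d hd
    rcases Nat.lt_or_gt_of_ne hd with h0 | h2
    · rw [Nat.lt_one_iff.mp h0, pow_zero, coeff_one, if_neg one_ne_zero, smul_zero]
    · rw [X_pow_dvd_iff.mp (pow_dvd_pow_of_dvd (X_dvd_iff.mpr hg) d) 1 h2, smul_zero]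

/-- **`[z¹] 𝓣[x(ξ(Ω + ·))] = ℘′(Ω)`** (`d/dv ℘(Ω + v)|₀ = ℘′(Ω)`). [cite: SilvermanAEC2009, VI.3.1] -/
theorem coeff_one_taylor_x_translate {Ω : ℂ} (hΩ : Ω ∉ L.lattice) :
    coeff 1 𝓣[fun v => ℘[L] (Ω + v) - W.b₂ / 12] = ℘'[L] Ω := by
  rw [coeff_one_taylor]
  have h℘ : HasDerivAt ℘[L] (℘'[L] Ω) (Ω + 0) := by
    rw [add_zero, ← L.deriv_weierstrassP]
    exact (L.analyticOnNhd_weierstrassP Ω (by simpa using hΩ)).differentiableAt.hasDerivAt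
  exact ((h℘.comp_const_add Ω 0).sub_const (W.b₂ / 12)).deriv

/-- ★★ **`𝓣[v ↦ y(ξ(Ω + v))] = translateY(ξ Ω) ∘ exp_W`** for `Ω ∉ Λ` with `℘′(Ω) ≠ 0` (`2Ω ∉ Λ`): the Taylor series at `0` of the
`y`-coordinate of `ξ(Ω + v) = P₀ + ξ(v)` IS the algebraic `t`-expansion `translateY` in the logarithmic coordinate `t = exp_W(z)`.  Proof:
both `y`-candidates satisfy the Weierstrass equation over the same `x = translateX ∘ exp_W` (`equation_translate_subst_formalExp`,
`equation_taylor_translate` + the `x`-theorem), so they are equal or «opposite» in the domain `ℂ⟦z⟧`; the opposite case has constant term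
`translateY(0) + y₀ + a₁x₀ + a₃ = [t¹] translateX = ℘′(Ω) ≠ 0` — contradiction. [cite: SilvermanAEC2009, VI.3.6, III.2.3, IV.1]
[cite: deShalit1987, II §4.9 (proof of (i))] -/
theorem taylor_y_translate_eq_translateY_subst_formalExp [W.IsElliptic] (h₂ : L.g₂ = W.c₄ / 12) (h₃ : L.g₃ = W.c₆ / 216) {Ω : ℂ}
    (hΩ : Ω ∉ L.lattice) (hΩ' : ℘'[L] Ω ≠ 0) :
    𝓣[fun v => (℘'[L] (Ω + v) - W.a₁ * (℘[L] (Ω + v) - W.b₂ / 12) - W.a₃) / 2] =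
      (W.translateY (℘[L] Ω - W.b₂ / 12) ((℘'[L] Ω - W.a₁ * (℘[L] Ω - W.b₂ / 12) - W.a₃) / 2)).subst W.formalExp := by
  obtain ⟨u, -, -, hu⟩ := PeriodPair.exists_addMonoidHom_of_g₂_g₃' (L := L) h₂ h₃
  obtain ⟨h₀, -⟩ := hu Ω hΩ
  have hX := taylor_weierstrassP_add_sub_eq_translateX_subst_formalExp L W h₂ h₃ hΩ
  have eA := equation_translate_subst_formalExp W h₀
  have eB := equation_taylor_translate L W h₂ h₃ hΩ
  rw [hX] at eB
  set TX := (W.translateX (℘[L] Ω - W.b₂ / 12) ((℘'[L] Ω - W.a₁ * (℘[L] Ω - W.b₂ / 12) - W.a₃) / 2)).subst W.formalExp with hTX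
  set TY := (W.translateY (℘[L] Ω - W.b₂ / 12) ((℘'[L] Ω - W.a₁ * (℘[L] Ω - W.b₂ / 12) - W.a₃) / 2)).subst W.formalExp with hTY
  set TY' := 𝓣[fun v => (℘'[L] (Ω + v) - W.a₁ * (℘[L] (Ω + v) - W.b₂ / 12) - W.a₃) / 2] with hTY'
  have hprod : (TY' - TY) * (TY' + TY + C W.a₁ * TX + C W.a₃) = 0 := by linear_combination eB - eA
  rcases mul_eq_zero.mp hprod with h | h
  · exact sub_eq_zero.mp h
  · exfalso
    have hc := congrArg constantCoeff h
    rw [map_add, map_add, map_add, map_mul, constantCoeff_C, constantCoeff_C, hTY', constantCoeff_taylor, hTY,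
      Literature.NumberTheory.EllipticCurves.constantCoeff_subst_of_constantCoeff_eq_zero' _ W.constantCoeff_formalExp, hTX,
      Literature.NumberTheory.EllipticCurves.constantCoeff_subst_of_constantCoeff_eq_zero' _ W.constantCoeff_formalExp,
      constantCoeff_translateX, map_zero, add_zero] at hc
    -- `translateY(0) + y₀ + a₁x₀ + a₃ = [t¹] translateX = [z¹] TX = ℘′(Ω)`
    have hkey := W.constantCoeff_translateY_add (℘[L] Ω - W.b₂ / 12) ((℘'[L] Ω - W.a₁ * (℘[L] Ω - W.b₂ / 12) - W.a₃) / 2)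
    have h1 : coeff 1 (W.translateX (℘[L] Ω - W.b₂ / 12) ((℘'[L] Ω - W.a₁ * (℘[L] Ω - W.b₂ / 12) - W.a₃) / 2)) = ℘'[L] Ω := by
      have hexp1 : coeff 1 W.formalExp = 1 := by
        have h := congrArg (coeff 1) W.formalExp_subst_formalLog
        rwa [coeff_one_subst_eq_mul'' _ W.constantCoeff_formalLog, coeff_one_formalLog, mul_one, coeff_one_X] at h
      have h := congrArg (coeff 1) hX
      rw [coeff_one_taylor_x_translate L W hΩ, coeff_one_subst_eq_mul'' _ W.constantCoeff_formalExp, hexp1, mul_one] at h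
      exact h.symm
    apply hΩ'
    rw [← h1, ← hkey]
    linear_combination hc

end WeierstrassCurve

end
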